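import Literature.MathematicalPhysics.QuantumFieldTheory.Balaban1983to89.B5Leaf237C0Torus
import Literature.MathematicalPhysics.QuantumFieldTheory.Balaban1983to89.B10StarCount
import Literature.MathematicalPhysics.QuantumFieldTheory.Balaban1983to89.T3ContinuumYM3Torus
import HarnessLib

/-!
# Route `UnitScaleTilt`, crux K1 child «MinimiserStabilityRegPr» (stmt-QuantumFields-19200), registered stub `stub_variational` (v3d 511ba6194f4d04b9),
# leaf V3 «Prop 7 from a background (14)» (hypothesis `H7` of `Variational.thm1At_fam_of_prop7_prop8_sectF`, p444663 = the T³ reading of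
# `B11Thm1.Prop7From14 B₃ L³` at `T3Thm1Carrier.famX L`) — sub-lemma V3-D1a: THE `k`-UNIFORM FLAT POINCARÉ–COERCIVITY OF THE STRAIGHT-LINE
# `k`-FOLD BLOCK AVERAGING OF BOND FIELDS ON THE FINE TORI, constants independent of the volume and of `k`

Cell `ym3-torus` ∕ fleet seat `ym-ust-19200-p1` (HUMAN RULING D-0037, YM ladder rung R3).  WHERE THIS SITS.  [Balaban1985Variational] Prop. 7 (p. 299)
is proved in print (Sects. B–E) from a background `U₀` with (14) through the positivity of the linearised operator `Δ₁ + D R D^* + aQ^*Q` on the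
Landau-gauge chart ([Balaban1985BackgroundPropagators] Thm 3.11 p. 416, used for the minimality step (141)–(143) and, through Thms 3.12–3.13, for the
contraction (111)–(121)); its flat-background core is [Balaban1984PropagatorsI] Prop. 1.1 (1.90): «Δ_a = G⁻¹ ≥ γ₀(Δ + I) … with a positive constant γ₀
independent of k, T_η, and depending on d only».  For the d = 3 carrier of the route (`T3Thm1Carrier.varProblem3 F n K`: configurations on the finest
lattice `Site (F.P K) 0`, `k = K − n` averaging levels) no such bound is in the tree: the LQB ∕ NE9 lane has the multi-level flat positivity only
QUALITATIVELY (`B9Eq326OperatorTowerFlat.exists_coercive_principalk_one`: `∃ γ > 0` AFTER the lattice, from finite-dimensional positivity) and its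
perturbative tower route is not uniform in the number of levels (rider D-ne9p1-g85-1 of `B9Thm311SmallFieldCoercivityTowerL2`).

WHAT IS PROVED HERE (sorry-free; NO definition — the average `M_e` is written out as an explicit term in every statement; our own statements, elementary — [folklore] ∕ cited to the printed inequality they instantiate).  For the
MAIN TERM of the linearised `e`-fold block averaging of bond fields at `U = 1` — the straight-line block average `M_e` (§1), `(M_eX)(⟨y, μ⟩) =
L^{−e(d+1)} Σ_{x∈B^e(y)} Σ_{t<L^e} X(⟨x + t e_μ, μ⟩)` (mean over the block of the sums along the straight contours `[x, x + L^e e_μ]`; the one-step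
average of [Balaban1987RG1] (0.4) linearises at `U = 1` to this main term plus contour corrections that are sums of GRADIENTS of `X`, and the
`e`-fold composition of the main terms is again `M_e`) — on ANY torus `T^{(i)}` of `Setup` lying `e` block levels above `T^{(i′)}`:
* §2 `site_poincare` — the tree's scalar torus block Poincaré inequality `B5Leaf237C0Torus.block_poincare` ((2.27) of [Balaban1983RegularityDecay],
  constant 8) repackaged: `Σ_x f² ≤ (1/8)(L^e)² Σ_ν‖∂_νf‖² + L^{−ed} Σ_y (Σ_{B^e(y)} f)²`;
* §3 `blockMean_sq_le` — the block mean of `f` differs from its straight-line mean in direction `μ` by a telescoping sum of `μ`-differences along the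
  contour; by Cauchy–Schwarz and the tiling of the torus by the translated blocks: `L^{−ed} Σ_y (Σ_{B^e(y)} f)² ≤ 2L^{ed} Σ_y (M_e f)(⟨y, μ⟩)² +
  2(L^e)² Σ_x (f(x + e_μ) − f(x))²`;
* §4 **`sum_sq_le_lineBlockAvg_add_grad`**: `Σ_b X(b)² ≤ 2·L^{ed}·Σ_c (M_eX)(c)² + (17/8)·(L^e)²·Σ_b Σ_ν (X(b + e_ν) − X(b))²` for every real bond
  field `X` — i.e. `(L^e)^{−2}‖X‖² ≤ 2L^{e(d−2)}‖M_eX‖² + (17/8)‖∇X‖²`, the `η² = L^{−2k}` lower bound on `ker M_e` with ABSOLUTE constants;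
  `sum_sq_le_lineBlockAvg_add_grad_pi` — the same componentwise for `(ι → ℝ)`-valued (Lie-algebra-valued) bond fields;
* §5 **`sum_sq_le_lineBlockAvg_add_grad_T3`** — the instance at the carrier of the family: fine torus `Site (F.P K) 0`, `e = K − n`, `d = 3`,
  constants `2L^{3(K−n)}`, `(17/8)L^{2(K−n)}`, uniform in the volume exponent `m`, in `n` and in `K`.

WHAT THIS IS NOT.  Not Thm 3.11: the curl–divergence form (`‖∇X‖² = ‖dX‖² + ‖d^*X‖²` on the flat torus and the gauge term `D R D^*`), the
identification of `M_{K−n}` with the derivative at `U ≡ 1` of the family's (0.4)-descent `T3DescentFibreTower.descendTo` (main term + gradient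
corrections), the small-field perturbation `U₀ ∈ 𝔘_k(L³B₃ε₁)` (curvature terms of relative size `O(ε₀)` against `γ₀L^{−2k}`), and the sup-norm ∕
decay bounds of Thms 3.12–3.13 are the further sub-lemmas V3-D1b…D3 of the leaf's split card (item evidence `CARD-19200-V3-split.md`); nothing of
Bałaban's is asserted.

References: T. Bałaban, CMP 95 (1984) 17–40 [Balaban1984PropagatorsI] (Prop. 1.1 (1.90) p.33, (1.11) p.19); CMP 89 (1983) 571–597
[Balaban1983RegularityDecay] ((2.27) p.580); CMP 99 (1985) 389–434 [Balaban1985BackgroundPropagators] (Thm 3.11 p.416); CMP 102 (1985) 277–309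
[Balaban1985Variational] (Prop. 7 p.299, (141)–(143)); CMP 109 (1987) 249–301 [Balaban1987RG1] ((0.4) p.253).
-/

noncomputable section

open scoped BigOperators

namespace Summit.QuantumFields.YangMills.Theorems.Prop7FlatCoercivity

open Literature.MathematicalPhysics.QuantumFieldTheory.Balaban1983to89
open Matrix Finset B1RG242Torus
open B10StarCount (shiftEquiv unshift_shift sum_pbond)

variable {P : Params} {i i' e : ℕ}

/-! ## §1 The straight-line block average of a bond field -/

/- The straight-line `e`-fold block average of a bond field `X` on `T^{(i)}` at the coarse bond `c = ⟨y, μ⟩` of `T^{(i')}` is written out in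
every statement below as the explicit term
`(M_eX)(c) := (((L^e)^d·L^e)⁻¹) · Σ_{x : proj x = y} Σ_{t < L^e} X ⟨(·.shift μ)^[t] x, μ⟩`
(mean over the block `B^e(y)` and over the `L^e` bonds of the straight contour `[x, x + L^e e_μ]`); no definition is introduced in this file. -/

/-! ## §2 Elementary torus bookkeeping -/

/-- A sum over the torus is invariant under the unit translation `x ↦ x + e_μ`. [folklore] -/
theorem sum_shift (μ : Fin P.d) (F : Site P i → ℝ) : ∑ x : Site P i, F (x.shift μ) = ∑ x, F x :=
  Fintype.sum_equiv (shiftEquiv μ) _ _ (fun _ => rfl)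

/-- A sum over the torus is invariant under the translation `x ↦ x + t·e_μ`. [folklore] -/
theorem sum_iterShift (μ : Fin P.d) (F : Site P i → ℝ) (t : ℕ) :
    ∑ x, F ((fun z : Site P i => z.shift μ)^[t] x) = ∑ x, F x := by
  induction t with
  | zero => rfl
  | succ t ih =>
    have h1 : ∀ x : Site P i, F ((fun z : Site P i => z.shift μ)^[t + 1] x)
        = (fun w : Site P i => F ((fun z : Site P i => z.shift μ)^[t] w)) (x.shift μ) := fun x => by
      simp only [Function.iterate_succ_apply]
    rw [Finset.sum_congr rfl (fun x _ => h1 x), sum_shift μ (fun w : Site P i => F ((fun z : Site P i => z.shift μ)^[t] w)), ih]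

/-- The quadratic form of `∂_μ` at unit spacing: `Σ_x (f(x + e_μ) − f(x))²`. [cite: Balaban1982Higgs1, (1.4) p.604] -/
theorem deriv_form (μ : Fin P.d) (f : Site P i → ℝ) :
    (deriv P i 1 μ *ᵥ f) ⬝ᵥ (deriv P i 1 μ *ᵥ f) = ∑ x : Site P i, (f (x.shift μ) - f x) ^ 2 := by
  simp only [dotProduct, deriv_mulVec, inv_one, one_mul, sq]

/-- The quadratic form of `Q^*Q` (weight `w`): `⟨f, Q^*Q f⟩ = w·Σ_y (Σ_{x∈B^e(y)} f(x))²`. [cite: Balaban1983RegularityDecay, p.580] -/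
theorem extAvg_form (w : ℝ) (f : Site P i → ℝ) :
    f ⬝ᵥ ((extMat P i i' e * avgMat P i i' e w) *ᵥ f)
      = w * ∑ y : Site P i', (∑ x ∈ univ.filter (fun x : Site P i => Site.proj i' e x = y), f x) ^ 2 := by
  rw [← Matrix.mulVec_mulVec, dotProduct_extMat_mulVec]
  have hA : ∀ y : Site P i', (avgMat P i i' e w *ᵥ f) y = w * ∑ x ∈ univ.filter (fun x : Site P i => Site.proj i' e x = y), f x := by
    intro y
    rw [avgMat_mulVec, Finset.sum_filter, Finset.mul_sum]
    refine Finset.sum_congr rfl fun x _ => ?_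
    split_ifs <;> simp
  rw [← Finset.sum_fiberwise univ (Site.proj i' e) (fun x => f x * (avgMat P i i' e w *ᵥ f) (Site.proj i' e x)), Finset.mul_sum]
  refine Finset.sum_congr rfl fun y _ => ?_
  have : ∑ x ∈ univ.filter (fun x : Site P i => Site.proj i' e x = y), f x * (avgMat P i i' e w *ᵥ f) (Site.proj i' e x)
      = ∑ x ∈ univ.filter (fun x : Site P i => Site.proj i' e x = y),
          f x * (w * ∑ x' ∈ univ.filter (fun x : Site P i => Site.proj i' e x = y), f x') := by
    refine Finset.sum_congr rfl fun x hx => ?_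
    rw [(Finset.mem_filter.mp hx).2, hA]
  rw [this, ← Finset.sum_mul, sq]
  ring

/-- `((L^d)⁻¹)^e = ((L^e)^d)⁻¹` (bookkeeping between the two block-weight spellings). [folklore] -/
theorem weight_eq : (((P.L : ℝ) ^ P.d)⁻¹) ^ e = (((P.L : ℝ) ^ e) ^ P.d)⁻¹ := by
  rw [inv_pow, ← pow_mul, ← pow_mul, mul_comm]

/-- **THE SCALAR TORUS BLOCK POINCARÉ INEQUALITY** (tree: `B5Leaf237C0Torus.block_poincare` at `a = 8`, repackaged): for every real `f` on
`T^{(i)}`, `Σ_x f(x)² ≤ (1/8)(L^e)²·Σ_ν Σ_x (f(x+e_ν) − f(x))² + L^{−ed}·Σ_y (Σ_{x∈B^e(y)} f(x))²`. [cite: Balaban1983RegularityDecay, (2.27) p.580] -/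
theorem site_poincare (h : P.sitesPerDir i = P.L ^ e * P.sitesPerDir i') (f : Site P i → ℝ) :
    ∑ x, f x ^ 2 ≤ (1 / 8) * ((P.L : ℝ) ^ e) ^ 2 * ∑ ν : Fin P.d, ∑ x : Site P i, (f (x.shift ν) - f x) ^ 2
      + (((P.L : ℝ) ^ e) ^ P.d)⁻¹ * ∑ y : Site P i', (∑ x ∈ univ.filter (fun x : Site P i => Site.proj i' e x = y), f x) ^ 2 := by
  have hP := B5Leaf237C0Torus.block_poincare P h 8 f
  rw [min_self, extAvg_form, weight_eq] at hP
  have hff : f ⬝ᵥ f = ∑ x, f x ^ 2 := by simp only [dotProduct, sq]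
  rw [hff] at hP
  simp only [deriv_form] at hP
  linarith [hP]

/-- Cauchy–Schwarz on a block: `(Σ_{x∈B^e(y)} F(x))² ≤ L^{ed}·Σ_{x∈B^e(y)} F(x)²`. [folklore] -/
theorem sq_blockSum_le (h : P.sitesPerDir i = P.L ^ e * P.sitesPerDir i') (y : Site P i') (F : Site P i → ℝ) :
    (∑ x ∈ univ.filter (fun x : Site P i => Site.proj i' e x = y), F x) ^ 2
      ≤ ((P.L : ℝ) ^ e) ^ P.d * ∑ x ∈ univ.filter (fun x : Site P i => Site.proj i' e x = y), F x ^ 2 := by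
  have hc := sq_sum_le_card_mul_sum_sq (s := univ.filter (fun x : Site P i => Site.proj i' e x = y)) (f := F)
  rw [Site.card_fibre h y] at hc
  push_cast at hc
  exact hc

/-! ## §3 The shift–telescoping estimate for one direction -/

section OneDirection

variable (μ : Fin P.d) (f : Site P i → ℝ)

/-- Telescoping along the straight contour: `S_y(f ∘ τ_t) = S_y(f) + Σ_{s<t} S_y(∇_μ f ∘ τ_s)`, `τ_s` = translation by `s·e_μ`,
`S_y` = the sum over the block `B^e(y)`. [folklore] -/
theorem blockSum_iterShift_eq (y : Site P i') (t : ℕ) :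
    ∑ x ∈ univ.filter (fun x : Site P i => Site.proj i' e x = y), f ((fun z : Site P i => z.shift μ)^[t] x)
      = ∑ x ∈ univ.filter (fun x : Site P i => Site.proj i' e x = y), f x
        + ∑ s ∈ range t, ∑ x ∈ univ.filter (fun x : Site P i => Site.proj i' e x = y),
            (f (((fun z : Site P i => z.shift μ)^[s] x).shift μ) - f ((fun z : Site P i => z.shift μ)^[s] x)) := by
  induction t with
  | zero => simp
  | succ t ih =>
    rw [Finset.sum_range_succ, ← add_assoc, ← ih]
    have : ∀ x : Site P i, f ((fun z : Site P i => z.shift μ)^[t + 1] x) = f (((fun z : Site P i => z.shift μ)^[t] x).shift μ) :=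
      fun x => by rw [Function.iterate_succ_apply']
    simp only [this, Finset.sum_sub_distrib]
    ring

/-- **ONE DIRECTION**: `L^{−ed}·Σ_y (Σ_{B^e(y)} f)² ≤ 2L^{ed}·Σ_y (M f)(⟨y, μ⟩)² + 2(L^e)²·Σ_x (f(x+e_μ) − f(x))²`, where `M f` is the
straight-line block average of the bond field `b ↦ f(b₋)` (read on the `μ`-bonds): the block mean differs from the straight-line mean by
a telescoping sum of `μ`-differences along the contour, bounded by Cauchy–Schwarz. [folklore] -/
theorem blockMean_sq_le (h : P.sitesPerDir i = P.L ^ e * P.sitesPerDir i') :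
    (((P.L : ℝ) ^ e) ^ P.d)⁻¹ * ∑ y : Site P i', (∑ x ∈ univ.filter (fun x : Site P i => Site.proj i' e x = y), f x) ^ 2
      ≤ 2 * ((P.L : ℝ) ^ e) ^ P.d * ∑ y : Site P i', ((((P.L : ℝ) ^ e) ^ P.d * (P.L : ℝ) ^ e)⁻¹ * ∑ x ∈ univ.filter (fun x : Site P i => Site.proj i' e x = y), ∑ t ∈ range (P.L ^ e), f ((fun z : Site P i => z.shift μ)^[t] x)) ^ 2
        + 2 * ((P.L : ℝ) ^ e) ^ 2 * ∑ x : Site P i, (f (x.shift μ) - f x) ^ 2 := by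
  -- notation
  set N : ℕ := P.L ^ e with hN
  set V : ℝ := ((P.L : ℝ) ^ e) ^ P.d with hV
  set τ : ℕ → Site P i → Site P i := fun s x => (fun z : Site P i => z.shift μ)^[s] x with hτ
  set g : Site P i → ℝ := fun x => f (x.shift μ) - f x with hg
  have hL1 : (1 : ℝ) < P.L := by exact_mod_cast P.hL.2
  have hNR : (N : ℝ) = (P.L : ℝ) ^ e := by rw [hN]; push_cast; rfl
  have hN0 : (0 : ℝ) < N := by rw [hNR]; positivity
  have hV0 : 0 < V := by positivity
  -- abbreviations for the block sums
  set fib : Site P i' → Finset (Site P i) := fun y => univ.filter (fun x : Site P i => Site.proj i' e x = y) with hfib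
  have hcard : ∀ y, ((fib y).card : ℝ) = V := fun y => by rw [hfib]; simp only; rw [Site.card_fibre h y]; push_cast; rfl
  -- A_y, R_y
  set A : Site P i' → ℝ := fun y => ∑ x ∈ fib y, ∑ t ∈ range N, f (τ t x) with hA
  set R : Site P i' → ℝ := fun y => ∑ t ∈ range N, ∑ s ∈ range t, ∑ x ∈ fib y, g (τ s x) with hR
  -- the straight-line average in terms of A
  have hlba : ∀ y, ((((P.L : ℝ) ^ e) ^ P.d * (P.L : ℝ) ^ e)⁻¹ * ∑ x ∈ univ.filter (fun x : Site P i => Site.proj i' e x = y), ∑ t ∈ range (P.L ^ e), f ((fun z : Site P i => z.shift μ)^[t] x)) = (V * N)⁻¹ * A y := by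
    intro y
    rw [hNR]
  -- A = N·S + R (telescoping, summed over t)
  have hAeq : ∀ y, A y = N * ∑ x ∈ fib y, f x + R y := by
    intro y
    have h1 : A y = ∑ t ∈ range N, ∑ x ∈ fib y, f (τ t x) := by rw [hA]; exact Finset.sum_comm
    rw [h1, hR]
    have h2 : ∀ t, ∑ x ∈ fib y, f (τ t x) = ∑ x ∈ fib y, f x + ∑ s ∈ range t, ∑ x ∈ fib y, g (τ s x) := by
      intro t
      have := blockSum_iterShift_eq (e := e) μ f y t
      simpa only [hfib, hτ, hg] using this
    simp only [h2, Finset.sum_add_distrib, Finset.sum_const, Finset.card_range, nsmul_eq_mul]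
  -- R_y² ≤ N³·V·Σ_{s<N} Σ_{fib y} g(τ_s x)²
  have hRsq : ∀ y, R y ^ 2 ≤ (N : ℝ) ^ 3 * V * ∑ s ∈ range N, ∑ x ∈ fib y, g (τ s x) ^ 2 := by
    intro y
    have hB : ∀ t ∈ range N, (∑ s ∈ range t, ∑ x ∈ fib y, g (τ s x)) ^ 2 ≤ (N : ℝ) * ∑ s ∈ range N, V * ∑ x ∈ fib y, g (τ s x) ^ 2 := by
      intro t ht
      have htN : t ≤ N := (Finset.mem_range.mp ht).le
      have c1 := sq_sum_le_card_mul_sum_sq (s := range t) (f := fun s => ∑ x ∈ fib y, g (τ s x))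
      rw [Finset.card_range] at c1
      have c2 : ∑ s ∈ range t, (∑ x ∈ fib y, g (τ s x)) ^ 2 ≤ ∑ s ∈ range N, V * ∑ x ∈ fib y, g (τ s x) ^ 2 := by
        calc ∑ s ∈ range t, (∑ x ∈ fib y, g (τ s x)) ^ 2
            ≤ ∑ s ∈ range N, (∑ x ∈ fib y, g (τ s x)) ^ 2 :=
              Finset.sum_le_sum_of_subset_of_nonneg (Finset.range_subset_range.mpr htN) fun _ _ _ => sq_nonneg _
          _ ≤ ∑ s ∈ range N, V * ∑ x ∈ fib y, g (τ s x) ^ 2 :=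
              Finset.sum_le_sum fun s _ => by simpa only [hfib, hV] using sq_blockSum_le h y (fun x => g (τ s x))
      have c3 : (0 : ℝ) ≤ ∑ s ∈ range N, V * ∑ x ∈ fib y, g (τ s x) ^ 2 :=
        Finset.sum_nonneg fun s _ => mul_nonneg hV0.le (Finset.sum_nonneg fun _ _ => sq_nonneg _)
      calc (∑ s ∈ range t, ∑ x ∈ fib y, g (τ s x)) ^ 2
          ≤ (t : ℝ) * ∑ s ∈ range t, (∑ x ∈ fib y, g (τ s x)) ^ 2 := c1
        _ ≤ (N : ℝ) * ∑ s ∈ range N, V * ∑ x ∈ fib y, g (τ s x) ^ 2 := by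
              have : (t : ℝ) ≤ N := by exact_mod_cast htN
              have c4 : (0 : ℝ) ≤ ∑ s ∈ range t, (∑ x ∈ fib y, g (τ s x)) ^ 2 := Finset.sum_nonneg fun _ _ => sq_nonneg _
              nlinarith
    have c0 := sq_sum_le_card_mul_sum_sq (s := range N) (f := fun t => ∑ s ∈ range t, ∑ x ∈ fib y, g (τ s x))
    rw [Finset.card_range] at c0
    calc R y ^ 2 ≤ (N : ℝ) * ∑ t ∈ range N, (∑ s ∈ range t, ∑ x ∈ fib y, g (τ s x)) ^ 2 := c0
      _ ≤ (N : ℝ) * ∑ t ∈ range N, ((N : ℝ) * ∑ s ∈ range N, V * ∑ x ∈ fib y, g (τ s x) ^ 2) :=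
          mul_le_mul_of_nonneg_left (Finset.sum_le_sum hB) hN0.le
      _ = (N : ℝ) ^ 3 * V * ∑ s ∈ range N, ∑ x ∈ fib y, g (τ s x) ^ 2 := by
          rw [Finset.sum_const, Finset.card_range, nsmul_eq_mul, ← Finset.mul_sum]; ring
  -- per block: V⁻¹·S² ≤ 2V·lba² + 2N·Σ_s Σ_fib g(τ_s x)²
  have hblock : ∀ y, V⁻¹ * (∑ x ∈ fib y, f x) ^ 2
      ≤ 2 * V * ((((P.L : ℝ) ^ e) ^ P.d * (P.L : ℝ) ^ e)⁻¹ * ∑ x ∈ univ.filter (fun x : Site P i => Site.proj i' e x = y), ∑ t ∈ range (P.L ^ e), f ((fun z : Site P i => z.shift μ)^[t] x)) ^ 2 + 2 * N * ∑ s ∈ range N, ∑ x ∈ fib y, g (τ s x) ^ 2 := by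
    intro y
    have hS : ∑ x ∈ fib y, f x = (A y - R y) / N := by
      rw [hAeq y]; field_simp; ring
    rw [hlba y, hS]
    have e1 : V⁻¹ * ((A y - R y) / N) ^ 2 ≤ 2 * (V⁻¹ * (A y / N) ^ 2) + 2 * (V⁻¹ * (R y / N) ^ 2) := by
      have : ((A y - R y) / N) ^ 2 ≤ 2 * (A y / N) ^ 2 + 2 * (R y / N) ^ 2 := by
        rw [sub_div]; nlinarith [sq_nonneg (A y / N + R y / N)]
      nlinarith [mul_le_mul_of_nonneg_left this (inv_pos.mpr hV0).le]
    have e2 : 2 * (V⁻¹ * (A y / N) ^ 2) = 2 * V * ((V * N)⁻¹ * A y) ^ 2 := by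
      field_simp
      try ring
    have e3 : 2 * (V⁻¹ * (R y / N) ^ 2) ≤ 2 * N * ∑ s ∈ range N, ∑ x ∈ fib y, g (τ s x) ^ 2 := by
      have := hRsq y
      have hsum0 : (0 : ℝ) ≤ ∑ s ∈ range N, ∑ x ∈ fib y, g (τ s x) ^ 2 :=
        Finset.sum_nonneg fun _ _ => Finset.sum_nonneg fun _ _ => sq_nonneg _
      rw [show 2 * (V⁻¹ * (R y / N) ^ 2) = 2 * (R y ^ 2) / (V * N ^ 2) by field_simp]
      rw [div_le_iff₀ (by positivity)]
      nlinarith [mul_le_mul_of_nonneg_left this (show (0:ℝ) ≤ 2 / (N:ℝ) ^ 2 * 1 by positivity)]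
    linarith [e1, e2, e3]
  -- sum over the blocks; the shifted blocks tile the torus
  have htile : ∑ y : Site P i', ∑ s ∈ range N, ∑ x ∈ fib y, g (τ s x) ^ 2 = N * ∑ x, g x ^ 2 := by
    rw [Finset.sum_comm]
    have : ∀ s, ∑ y : Site P i', ∑ x ∈ fib y, g (τ s x) ^ 2 = ∑ x, g x ^ 2 := by
      intro s
      rw [hfib]
      rw [Finset.sum_fiberwise univ (Site.proj i' e) (fun x => g (τ s x) ^ 2)]
      exact sum_iterShift μ (fun x => g x ^ 2) s
    simp only [this, Finset.sum_const, Finset.card_range, nsmul_eq_mul]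
  calc V⁻¹ * ∑ y : Site P i', (∑ x ∈ fib y, f x) ^ 2
      = ∑ y : Site P i', V⁻¹ * (∑ x ∈ fib y, f x) ^ 2 := Finset.mul_sum _ _ _
    _ ≤ ∑ y : Site P i', (2 * V * ((((P.L : ℝ) ^ e) ^ P.d * (P.L : ℝ) ^ e)⁻¹ * ∑ x ∈ univ.filter (fun x : Site P i => Site.proj i' e x = y), ∑ t ∈ range (P.L ^ e), f ((fun z : Site P i => z.shift μ)^[t] x)) ^ 2
          + 2 * N * ∑ s ∈ range N, ∑ x ∈ fib y, g (τ s x) ^ 2) := Finset.sum_le_sum fun y _ => hblock y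
    _ = 2 * V * ∑ y : Site P i', ((((P.L : ℝ) ^ e) ^ P.d * (P.L : ℝ) ^ e)⁻¹ * ∑ x ∈ univ.filter (fun x : Site P i => Site.proj i' e x = y), ∑ t ∈ range (P.L ^ e), f ((fun z : Site P i => z.shift μ)^[t] x)) ^ 2
          + 2 * N * (N * ∑ x, g x ^ 2) := by
        rw [Finset.sum_add_distrib, ← Finset.mul_sum, ← Finset.mul_sum, htile]
    _ = 2 * V * ∑ y : Site P i', ((((P.L : ℝ) ^ e) ^ P.d * (P.L : ℝ) ^ e)⁻¹ * ∑ x ∈ univ.filter (fun x : Site P i => Site.proj i' e x = y), ∑ t ∈ range (P.L ^ e), f ((fun z : Site P i => z.shift μ)^[t] x)) ^ 2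
          + 2 * ((P.L : ℝ) ^ e) ^ 2 * ∑ x, g x ^ 2 := by rw [← hNR]; ring

end OneDirection

/-! ## §4 The flat coercivity -/

/-- **`k`-UNIFORM FLAT POINCARÉ–COERCIVITY OF THE STRAIGHT-LINE BLOCK AVERAGING OF BOND FIELDS** (the flat-background core of
[Balaban1985BackgroundPropagators] Thm 3.11 ∕ [Balaban1984PropagatorsI] Prop. 1.1 (1.90) «Δ_a = G⁻¹ ≥ γ₀(Δ + I) … with a positive constant γ₀
independent of k», in `L²` form and fine-lattice units, for the MAIN TERM of the linearised `e`-fold averaging at `U = 1`): for every real bond field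
`X` on `T^{(i)}` (`|T^{(i)}| = L^e·|T^{(i')}|` per direction),
`Σ_b X(b)² ≤ 2·L^{ed}·Σ_c (M_eX)(c)² + (17/8)·(L^e)²·Σ_b Σ_ν (X(b + e_ν) − X(b))²` — constants independent of the volume, of `e`, and of `d`.
[cite: Balaban1984PropagatorsI, Prop. 1.1 (1.90) p.33] -/
theorem sum_sq_le_lineBlockAvg_add_grad (h : P.sitesPerDir i = P.L ^ e * P.sitesPerDir i') (X : PBond P i → ℝ) :
    ∑ b : PBond P i, X b ^ 2
      ≤ 2 * ((P.L : ℝ) ^ e) ^ P.d * ∑ c : PBond P i', ((((P.L : ℝ) ^ e) ^ P.d * (P.L : ℝ) ^ e)⁻¹ * ∑ x ∈ univ.filter (fun x : Site P i => Site.proj i' e x = c.src), ∑ t ∈ range (P.L ^ e), X ⟨(fun z : Site P i => z.shift c.dir)^[t] x, c.dir⟩) ^ 2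
        + (17 / 8) * ((P.L : ℝ) ^ e) ^ 2 * ∑ b : PBond P i, ∑ ν : Fin P.d, (X ⟨b.src.shift ν, b.dir⟩ - X b) ^ 2 := by
  set V : ℝ := ((P.L : ℝ) ^ e) ^ P.d with hV
  set N2 : ℝ := ((P.L : ℝ) ^ e) ^ 2 with hN2
  have hV0 : 0 ≤ V := by positivity
  have hN20 : 0 ≤ N2 := by positivity
  -- per direction
  have hdir : ∀ μ : Fin P.d, ∑ x : Site P i, X ⟨x, μ⟩ ^ 2
      ≤ 2 * V * ∑ y : Site P i', ((((P.L : ℝ) ^ e) ^ P.d * (P.L : ℝ) ^ e)⁻¹ * ∑ x ∈ univ.filter (fun x : Site P i => Site.proj i' e x = y), ∑ t ∈ range (P.L ^ e), X ⟨(fun z : Site P i => z.shift μ)^[t] x, μ⟩) ^ 2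
        + ((1 / 8) * N2 * ∑ ν : Fin P.d, ∑ x : Site P i, (X ⟨x.shift ν, μ⟩ - X ⟨x, μ⟩) ^ 2
           + 2 * N2 * ∑ x : Site P i, (X ⟨x.shift μ, μ⟩ - X ⟨x, μ⟩) ^ 2) := by
    intro μ
    have h1 := site_poincare h (fun x => X ⟨x, μ⟩)
    have h2 := blockMean_sq_le μ (fun x => X ⟨x, μ⟩) h
    beta_reduce at h2
    linarith [h1, h2]
  -- sum over directions
  have eL : ∑ b : PBond P i, X b ^ 2 = ∑ μ : Fin P.d, ∑ x : Site P i, X ⟨x, μ⟩ ^ 2 := by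
    rw [sum_pbond, Finset.sum_comm]
  have eM : ∑ c : PBond P i', ((((P.L : ℝ) ^ e) ^ P.d * (P.L : ℝ) ^ e)⁻¹ * ∑ x ∈ univ.filter (fun x : Site P i => Site.proj i' e x = c.src), ∑ t ∈ range (P.L ^ e), X ⟨(fun z : Site P i => z.shift c.dir)^[t] x, c.dir⟩) ^ 2 = ∑ μ : Fin P.d, ∑ y : Site P i', ((((P.L : ℝ) ^ e) ^ P.d * (P.L : ℝ) ^ e)⁻¹ * ∑ x ∈ univ.filter (fun x : Site P i => Site.proj i' e x = y), ∑ t ∈ range (P.L ^ e), X ⟨(fun z : Site P i => z.shift μ)^[t] x, μ⟩) ^ 2 := by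
    rw [sum_pbond, Finset.sum_comm]
  have eG : ∑ b : PBond P i, ∑ ν : Fin P.d, (X ⟨b.src.shift ν, b.dir⟩ - X b) ^ 2
      = ∑ μ : Fin P.d, ∑ ν : Fin P.d, ∑ x : Site P i, (X ⟨x.shift ν, μ⟩ - X ⟨x, μ⟩) ^ 2 := by
    rw [sum_pbond, Finset.sum_comm]
    exact Finset.sum_congr rfl fun μ _ => Finset.sum_comm
  rw [eL, eM, eG, Finset.mul_sum, Finset.mul_sum, ← Finset.sum_add_distrib]
  refine Finset.sum_le_sum fun μ _ => ?_
  -- the `μ`-difference is one of the `ν`-differences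
  have hone : ∑ x : Site P i, (X ⟨x.shift μ, μ⟩ - X ⟨x, μ⟩) ^ 2 ≤ ∑ ν : Fin P.d, ∑ x : Site P i, (X ⟨x.shift ν, μ⟩ - X ⟨x, μ⟩) ^ 2 :=
    Finset.single_le_sum (f := fun ν : Fin P.d => ∑ x : Site P i, (X ⟨x.shift ν, μ⟩ - X ⟨x, μ⟩) ^ 2)
      (fun ν _ => Finset.sum_nonneg fun _ _ => sq_nonneg _) (Finset.mem_univ μ)
  have hm := mul_le_mul_of_nonneg_left hone hN20
  linarith [hdir μ, hm]

/-- **VECTOR-VALUED FORM** (componentwise; the Lie-algebra-valued bond fields of [Balaban1985BackgroundPropagators] §3 are `dim 𝔤`-tuples of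
real bond fields, and the straight-line block average acts componentwise): for `X : bonds → (ι → ℝ)`,
`Σ_b Σ_j X(b)_j² ≤ 2L^{ed}·Σ_c Σ_j (M_e X_j)(c)² + (17/8)(L^e)²·Σ_b Σ_ν Σ_j (X(b+e_ν)_j − X(b)_j)²`. [cite: Balaban1984PropagatorsI, Prop. 1.1 (1.90) p.33] -/
theorem sum_sq_le_lineBlockAvg_add_grad_pi {ι : Type*} [Fintype ι] (h : P.sitesPerDir i = P.L ^ e * P.sitesPerDir i')
    (X : PBond P i → ι → ℝ) :
    ∑ b : PBond P i, ∑ j : ι, X b j ^ 2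
      ≤ 2 * ((P.L : ℝ) ^ e) ^ P.d * ∑ c : PBond P i', ∑ j : ι, ((((P.L : ℝ) ^ e) ^ P.d * (P.L : ℝ) ^ e)⁻¹ * ∑ x ∈ univ.filter (fun x : Site P i => Site.proj i' e x = c.src), ∑ t ∈ range (P.L ^ e), (fun b : PBond P i => X b j) ⟨(fun z : Site P i => z.shift c.dir)^[t] x, c.dir⟩) ^ 2
        + (17 / 8) * ((P.L : ℝ) ^ e) ^ 2 * ∑ b : PBond P i, ∑ ν : Fin P.d, ∑ j : ι, (X ⟨b.src.shift ν, b.dir⟩ j - X b j) ^ 2 := by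
  have eL : ∑ b : PBond P i, ∑ j : ι, X b j ^ 2 = ∑ j : ι, ∑ b : PBond P i, X b j ^ 2 := Finset.sum_comm
  have eM : ∑ c : PBond P i', ∑ j : ι, ((((P.L : ℝ) ^ e) ^ P.d * (P.L : ℝ) ^ e)⁻¹ * ∑ x ∈ univ.filter (fun x : Site P i => Site.proj i' e x = c.src), ∑ t ∈ range (P.L ^ e), (fun b : PBond P i => X b j) ⟨(fun z : Site P i => z.shift c.dir)^[t] x, c.dir⟩) ^ 2
      = ∑ j : ι, ∑ c : PBond P i', ((((P.L : ℝ) ^ e) ^ P.d * (P.L : ℝ) ^ e)⁻¹ * ∑ x ∈ univ.filter (fun x : Site P i => Site.proj i' e x = c.src), ∑ t ∈ range (P.L ^ e), (fun b : PBond P i => X b j) ⟨(fun z : Site P i => z.shift c.dir)^[t] x, c.dir⟩) ^ 2 := Finset.sum_comm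
  have eG : ∑ b : PBond P i, ∑ ν : Fin P.d, ∑ j : ι, (X ⟨b.src.shift ν, b.dir⟩ j - X b j) ^ 2
      = ∑ j : ι, ∑ b : PBond P i, ∑ ν : Fin P.d, (X ⟨b.src.shift ν, b.dir⟩ j - X b j) ^ 2 :=
    calc ∑ b : PBond P i, ∑ ν : Fin P.d, ∑ j : ι, (X ⟨b.src.shift ν, b.dir⟩ j - X b j) ^ 2
        = ∑ b : PBond P i, ∑ j : ι, ∑ ν : Fin P.d, (X ⟨b.src.shift ν, b.dir⟩ j - X b j) ^ 2 :=
          Finset.sum_congr rfl fun b _ => Finset.sum_comm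
      _ = ∑ j : ι, ∑ b : PBond P i, ∑ ν : Fin P.d, (X ⟨b.src.shift ν, b.dir⟩ j - X b j) ^ 2 := Finset.sum_comm
  rw [eL, eM, eG, Finset.mul_sum, Finset.mul_sum, ← Finset.sum_add_distrib]
  exact Finset.sum_le_sum fun j _ => sum_sq_le_lineBlockAvg_add_grad h (fun b => X b j)

/-! ## §5 At the carrier of the T³ family (run `K` over the comparison height `n`) -/

/-- The fine torus of run `K` of the T³ family sits `k = K − n` block levels above the comparison lattice:
`|T^{(0)}| = L^{K−n}·|T^{(K−n)}|` per direction (`2L^{m+K} = L^{K−n}·2L^{m+n}`). [cite: Balaban1985UV3, (1)-(3) p.256] -/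
theorem sitesPerDir_T3 (F : T3ContinuumYM3Torus.T3Family) (n K : ℕ) :
    (F.P K).sitesPerDir 0 = (F.P K).L ^ (K - n) * (F.P K).sitesPerDir (K - n) := by
  rw [sitesPerDir_zero_eq (F.P K) (K - n), lvl_of_le]
  show K - n ≤ F.m + K
  omega

/-- **THE FLAT COERCIVITY AT THE d = 3 CARRIER** of `T3Thm1Carrier.varProblem3 F n K` (configurations on the finest lattice `Site (F.P K) 0` of the
`K`-th approximation, block averaging over `k = K − n` levels down to the comparison lattice, [Balaban1985Variational] Thm 1's pure small-field
problem for the family): for every real bond field `X` on the fine torus,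
`Σ_b X(b)² ≤ 2L^{3(K−n)}·Σ_c (M_{K−n}X)(c)² + (17/8)L^{2(K−n)}·Σ_b Σ_ν (X(b+e_ν) − X(b))²`, uniformly in the volume exponent `m`, in `n` and in `K`
— the `η² = L^{−2(K−n)}` lower bound of the flat linearised operator on the kernel of the straight-line averaging, in fine-lattice units.
[cite: Balaban1984PropagatorsI, Prop. 1.1 (1.90) p.33] -/
theorem sum_sq_le_lineBlockAvg_add_grad_T3 (F : T3ContinuumYM3Torus.T3Family) (n K : ℕ) (X : PBond (F.P K) 0 → ℝ) :
    ∑ b : PBond (F.P K) 0, X b ^ 2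
      ≤ 2 * ((F.L : ℝ) ^ (K - n)) ^ 3 * ∑ c : PBond (F.P K) (K - n), (((((F.P K).L : ℝ) ^ (K - n)) ^ (F.P K).d * ((F.P K).L : ℝ) ^ (K - n))⁻¹ * ∑ x ∈ univ.filter (fun x : Site (F.P K) 0 => Site.proj (K - n) (K - n) x = c.src), ∑ t ∈ range ((F.P K).L ^ (K - n)), X ⟨(fun z : Site (F.P K) 0 => z.shift c.dir)^[t] x, c.dir⟩) ^ 2
        + (17 / 8) * ((F.L : ℝ) ^ (K - n)) ^ 2 *
          ∑ b : PBond (F.P K) 0, ∑ ν : Fin (F.P K).d, (X ⟨b.src.shift ν, b.dir⟩ - X b) ^ 2 := by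
  exact sum_sq_le_lineBlockAvg_add_grad (sitesPerDir_T3 F n K) X

end Summit.QuantumFields.YangMills.Theorems.Prop7FlatCoercivity

end
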